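import Summits.AtomisticToContinuum.Crystallization.Theorems.ChartedZeroExcessLayeredLatticeLiouvilleZZZYMA

/-!
# ChartedZeroExcess · LayeredLatticeLiouville ZZZYM (lens-2 g95 NODE 95b «TensionCredit») — part B (sequel of `…ChartedZeroExcessLayeredLatticeLiouvilleZZZYMA`)

Split for the 400-line cap; the module docstring of part A describes the whole node.  This part: §3 — the generic ledger floor `SoftLedgerFloorWithP pl …`
(the (QLᴸ) text over an arbitrary bond ledger), the GENERIC GLUE `softBregmanCoerciveP_of_dominatedLedger` ((LDᴸ) + bondwise domination + `pl`-floor ⟹ (BCᴸ)(c)),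
the piece (QL♯ᴸ)(c) `SoftLedgerSharpP` (the floor of the SHARP ledger `pairLedgerSharp` of part A: tension credits kept), its one-piece glue
`softBregmanCoerciveP_of_sharpLedger : (QL♯ᴸ)(c) → (BCᴸ)(c)` and the door `mildCoherentMoatCorePG_W2m`.  Same namespace; 2 defs (`Prop` statements) + 6 theorems + 1 example;
0 sorry; standard axioms. [g95]
-/

noncomputable section
open scoped BigOperators Classical InnerProductSpace RealInnerProductSpace
open MeasureTheory Set Metric Filter Topology
open Literature.MathematicalPhysics.StatisticalMechanics (lennardJones interactionEnergy)

namespace Summit.AtomisticToContinuum.Crystallization.Theorems.ChartedZeroExcessLayeredLatticeLiouville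

open Summit.AtomisticToContinuum.Crystallization.Theorems.ChartedPlanarOrderRigidityDoor (E3 IsClean)
open Summit.AtomisticToContinuum.Crystallization.Theorems.ChartedPlanarOrderDensityDichotomy (μS IsSep)
open Summit.AtomisticToContinuum.Crystallization.Theorems.ChartedPlanarOrderCleanScaleP (IsCleanP IsDoorSetP)
open Summit.AtomisticToContinuum.Crystallization.Theorems.ChartedPlanarOrderMesoCut (LayeredHom EnvClose)
open Summit.AtomisticToContinuum.Crystallization.Theorems.ChartedPlanarOrderDoorLayeredOsc (IsTwoShellAffineGood)
open Summit.AtomisticToContinuum.Crystallization.Theorems.ChartedPlanarOrderNashForceBalance (ljDeriv pairDeriv hasDerivAt_lennardJones)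

/-! ### ZZZYM-3  The generic ledger floor, its glue, the sharp piece (QL♯ᴸ) and door W2m -/

section SharpPiece

/-- ★★ **`SoftLedgerFloorWithP pl …` — THE LEDGER FLOOR OVER AN ARBITRARY BOND LEDGER `pl : E3 → E3 → ℝ`**: the text of (QLᴸ) `SoftLedgerFloorP` (file ZZZYL) with
`pairLedgerLower` replaced by `pl` — binders of (BCᴸ) verbatim; conclusion: the exterior `pl`-families are summable and
`c · pairDevSq Rg (lab ∘ xf) y z ≤ Σ_{i<j} pl (y i − y j) ((z i − z j) − (y i − y j)) + Σ_i Σ'_q pl (y i − q) (z i − y i)`.  `SoftLedgerFloorP` is the instance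
`pl = pairLedgerLower` (`softLedgerFloorP_iff`), (QL♯ᴸ) below the instance `pl = pairLedgerSharp`. [this file, g95 · statement schema] -/
def SoftLedgerFloorWithP (pl : E3 → E3 → ℝ) (ϑc ϑ ϑp r rΘ q rsh ρ rm σ ϑr Rs ε rI ℓ Rg sb₁ dI₁ dB₁ sbp dIp dBp Rd τ c aHi Λ θ s : ℝ) : Prop :=
  ∀ δ : ℝ, 0 < δ → ∀ a : ℝ, 0 < a →
    ∀ S : Set E3, IsDoorSetP aHi δ S → (∀ z : E3, Summable fun y : S => lennardJones (dist z (y : E3))) →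
      (∀ p ∈ S, IsTwoShellAffineGood θ S p) →
        ∀ (L : E3 ≃L[ℝ] E3) (w : ℤ → E3), IsEquilChart a s Λ L w →
          ∀ (x₀ : E3) (K : Set E3), K ⊆ S → (∀ k ∈ K, dist k x₀ ≤ q) →
            IsTameOn ϑp S (LayeredHom (L : E3 →L[ℝ] E3) w) (coreOf S K rm) →
              IsTameOn ϑc S (LayeredHom (L : E3 →L[ℝ] E3) w) (moatIn S K r (r + rsh)) →
                ∀ (n : ℕ) (xf : Fin n → E3), Function.Injective xf → Set.range xf = coreOf S K ρ →
                  ∀ (L' : E3 →L[ℝ] E3) (w' : ℤ → E3) (U : E3 ≃ₗᵢ[ℝ] E3) (t : E3),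
                    IsCoolShadowCrystal σ ϑr Rs ε r rI ℓ S K (LayeredHom (L : E3 →L[ℝ] E3) w) L' w' U t →
                      ∀ lab : E3 → E3, IsBondLabel ε rΘ ℓ S K (placedCrystal L' w' U t) lab →
                        ∀ y ∈ bondTube (S \ coreOf S K ρ) Rg sb₁ dI₁ dB₁ (fun i => lab (xf i)),
                          Function.Injective y → Disjoint (Set.range y) (S \ coreOf S K ρ) →
                            HasFDerivAt (fun z : Fin n → E3 => clampedEnergy (S \ coreOf S K ρ) z) (0 : (Fin n → E3) →L[ℝ] ℝ) y →
                              (∀ i, IsTameStar ϑ ((S \ coreOf S K ρ) ∪ Set.range y) (LayeredHom (L : E3 →L[ℝ] E3) w) (y i)) →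
                              (∀ z ∈ bondTube (S \ coreOf S K ρ) Rg sb₁ dI₁ dB₁ (fun i => lab (xf i)),
                                  clampedEnergy (S \ coreOf S K ρ) y ≤ clampedEnergy (S \ coreOf S K ρ) z) →
                                ∀ z ∈ bondTube (S \ coreOf S K ρ) Rg sbp dIp dBp (fun i => lab (xf i)),
                                  IsSoftAbout Rd τ (fun i => lab (xf i)) y z →
                                    (∀ i : Fin n, Summable fun q' : ↥(S \ coreOf S K ρ) => pl (y i - (q' : E3)) (z i - y i)) ∧
                                      c * pairDevSq Rg (fun i => lab (xf i)) y z ≤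
                                        (∑ i, ∑ j ∈ Finset.Ioi i, pl (y i - y j) ((z i - z j) - (y i - y j))) +
                                          ∑ i, ∑' q' : ↥(S \ coreOf S K ρ), pl (y i - (q' : E3)) (z i - y i)

variable {ϑc ϑ ϑp r rΘ q rsh ρ rm σ ϑr Rs ε rI ℓ Rg sb₁ dI₁ dB₁ sbp dIp dBp Rd τ c c' g₀ aHi Λ θ s : ℝ}

/-- (QLᴸ) of ZZZYL is the instance `pl = pairLedgerLower` of the schema (definitional). [formal bookkeeping] -/
theorem softLedgerFloorP_iff :
    SoftLedgerFloorP ϑc ϑ ϑp r rΘ q rsh ρ rm σ ϑr Rs ε rI ℓ Rg sb₁ dI₁ dB₁ sbp dIp dBp Rd τ c aHi Λ θ s ↔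
      SoftLedgerFloorWithP pairLedgerLower ϑc ϑ ϑp r rΘ q rsh ρ rm σ ϑr Rs ε rI ℓ Rg sb₁ dI₁ dB₁ sbp dIp dBp Rd τ c aHi Λ θ s := Iff.rfl

/-- the schema is antitone in the modulus `c`. [formal bookkeeping] -/
theorem SoftLedgerFloorWithP.of_le {pl : E3 → E3 → ℝ} (hc : c' ≤ c)
    (h : SoftLedgerFloorWithP pl ϑc ϑ ϑp r rΘ q rsh ρ rm σ ϑr Rs ε rI ℓ Rg sb₁ dI₁ dB₁ sbp dIp dBp Rd τ c aHi Λ θ s) :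
    SoftLedgerFloorWithP pl ϑc ϑ ϑp r rΘ q rsh ρ rm σ ϑr Rs ε rI ℓ Rg sb₁ dI₁ dB₁ sbp dIp dBp Rd τ c' aHi Λ θ s := by
  intro δ hδ a ha S hS hsum hgood L w hLw x₀ K hKS hKq hmild hcool n xf hxf hrange L' w' U t hC lab hlab y hy hyinj hydisj hcrit htame hmin z hz hsoft
  obtain ⟨h1, h2⟩ := h δ hδ a ha S hS hsum hgood L w hLw x₀ K hKS hKq hmild hcool n xf hxf hrange L' w' U t hC lab hlab y hy hyinj hydisj hcrit htame hmin
    z hz hsoft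
  exact ⟨h1, (mul_le_mul_of_nonneg_right hc (pairDevSq_nonneg Rg (fun i => lab (xf i)) y z)).trans h2⟩

/-- ★★★ **THE GENERIC LEDGER GLUE (PROVED, all dials): (LDᴸ) ∧ [bondwise domination of `pl`] ∧ [`pl`-floor](c) ⟹ (BCᴸ)(c).**  The proof of ZZZYL's
`softBregmanCoerciveP_of_ledger` with `pairLedgerLower_le_pairTerm` abstracted into the hypothesis
`hdom : pl (x − q) v ≤ V(‖x + v − q‖) − V(‖x − q‖) − pairDeriv x q v` (`x ≠ q`). [this file, g95] -/
theorem softBregmanCoerciveP_of_dominatedLedger {pl : E3 → E3 → ℝ}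
    (hdom : ∀ ⦃x q' : E3⦄, x ≠ q' → ∀ v : E3, pl (x - q') v ≤ lennardJones ‖x + v - q'‖ - lennardJones ‖x - q'‖ - pairDeriv x q' v)
    (hLD : FirstVariationP ϑc ϑ ϑp r rΘ q rsh ρ rm σ ϑr Rs ε rI ℓ Rg sb₁ dI₁ dB₁ aHi Λ θ s)
    (hQL : SoftLedgerFloorWithP pl ϑc ϑ ϑp r rΘ q rsh ρ rm σ ϑr Rs ε rI ℓ Rg sb₁ dI₁ dB₁ sbp dIp dBp Rd τ c aHi Λ θ s) :
    SoftBregmanCoerciveP ϑc ϑ ϑp r rΘ q rsh ρ rm σ ϑr Rs ε rI ℓ Rg sb₁ dI₁ dB₁ sbp dIp dBp Rd τ c aHi Λ θ s := by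
  intro δ hδ a ha S hS hsum hgood L w hLw x₀ K hKS hKq hmild hcool n xf hxf hrange L' w' U t hC lab hlab y hy hyinj hydisj hcrit htame hmin z hz hsoft
  obtain ⟨Λ', hΛ', hsumD, hΛw⟩ := hLD δ hδ a ha S hS hsum hgood L w hLw x₀ K hKS hKq hmild hcool n xf hxf hrange L' w' U t hC lab hlab y hy hyinj hydisj
    hcrit htame hmin
  obtain ⟨hsumL, hQ⟩ := hQL δ hδ a ha S hS hsum hgood L w hLw x₀ K hKS hKq hmild hcool n xf hxf hrange L' w' U t hC lab hlab y hy hyinj hydisj hcrit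
    htame hmin z hz hsoft
  set X : Set E3 := S \ coreOf S K ρ with hX
  have hΛ0 : Λ' = 0 := hΛ'.unique hcrit
  have hlin : (∑ i, ∑ j ∈ Finset.Ioi i, pairDeriv (y i) (y j) ((z i - y i) - (z j - y j))) +
      ∑ i, ∑' q' : ↥X, pairDeriv (y i) (q' : E3) (z i - y i) = 0 := by
    have e := hΛw (z - y)
    rw [hΛ0] at e
    simpa using e.symm
  have hsumV : ∀ x : E3, Summable fun q' : ↥X => lennardJones (dist x (q' : E3)) := fun x =>
    summable_subset (g := fun q => lennardJones (dist x q)) (hsum x) fun _ hq => hq.1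
  have hy_ne : ∀ (i : Fin n) (q' : ↥X), y i ≠ (q' : E3) := fun i q' h =>
    (Set.disjoint_left.1 hydisj (Set.mem_range_self i)) (h ▸ q'.2)
  have hint : ∀ i j : Fin n, j ∈ Finset.Ioi i →
      pl (y i - y j) ((z i - z j) - (y i - y j)) ≤
        lennardJones (dist (z i) (z j)) - lennardJones (dist (y i) (y j)) - pairDeriv (y i) (y j) ((z i - y i) - (z j - y j)) := by
    intro i j hj
    have hij : y i ≠ y j := fun h => (Finset.mem_Ioi.1 hj).ne (hyinj h)
    have key := hdom hij ((z i - y i) - (z j - y j))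
    have e1 : y i + ((z i - y i) - (z j - y j)) - y j = z i - z j := by abel
    have e2 : (z i - z j) - (y i - y j) = (z i - y i) - (z j - y j) := by abel
    rw [e1] at key
    rw [e2, dist_eq_norm, dist_eq_norm]
    exact key
  have hext : ∀ (i : Fin n) (q' : ↥X),
      pl (y i - (q' : E3)) (z i - y i) ≤
        lennardJones (dist (z i) (q' : E3)) - lennardJones (dist (y i) (q' : E3)) - pairDeriv (y i) (q' : E3) (z i - y i) := by
    intro i q'
    have key := hdom (hy_ne i q') (z i - y i)
    have e1 : y i + (z i - y i) - (q' : E3) = z i - (q' : E3) := by abel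
    rw [e1] at key
    rw [dist_eq_norm, dist_eq_norm]
    exact key
  have hext_sum : ∀ i : Fin n, ∑' q' : ↥X, pl (y i - (q' : E3)) (z i - y i) ≤
      (∑' q' : ↥X, lennardJones (dist (z i) (q' : E3))) - (∑' q' : ↥X, lennardJones (dist (y i) (q' : E3))) -
        ∑' q' : ↥X, pairDeriv (y i) (q' : E3) (z i - y i) := by
    intro i
    have hs3 : Summable fun q' : ↥X =>
        lennardJones (dist (z i) (q' : E3)) - lennardJones (dist (y i) (q' : E3)) - pairDeriv (y i) (q' : E3) (z i - y i) :=
      ((hsumV (z i)).sub (hsumV (y i))).sub (hsumD i (z i - y i))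
    have h1 := (hsumL i).tsum_le_tsum (hext i) hs3
    rw [((hsumV (z i)).sub (hsumV (y i))).tsum_sub (hsumD i (z i - y i)), (hsumV (z i)).tsum_sub (hsumV (y i))] at h1
    exact h1
  have hint_sum : (∑ i, ∑ j ∈ Finset.Ioi i, pl (y i - y j) ((z i - z j) - (y i - y j))) ≤
      ∑ i, ∑ j ∈ Finset.Ioi i,
        (lennardJones (dist (z i) (z j)) - lennardJones (dist (y i) (y j)) - pairDeriv (y i) (y j) ((z i - y i) - (z j - y j))) :=
    Finset.sum_le_sum fun i _ => Finset.sum_le_sum fun j hj => hint i j hj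
  have hext_tot : (∑ i, ∑' q' : ↥X, pl (y i - (q' : E3)) (z i - y i)) ≤
      ∑ i, ((∑' q' : ↥X, lennardJones (dist (z i) (q' : E3))) - (∑' q' : ↥X, lennardJones (dist (y i) (q' : E3))) -
        ∑' q' : ↥X, pairDeriv (y i) (q' : E3) (z i - y i)) :=
    Finset.sum_le_sum fun i _ => hext_sum i
  have hEz : clampedEnergy X z = (∑ i, ∑ j ∈ Finset.Ioi i, lennardJones (dist (z i) (z j))) + ∑ i, ∑' q' : ↥X, lennardJones (dist (z i) (q' : E3)) := rfl
  have hEy : clampedEnergy X y = (∑ i, ∑ j ∈ Finset.Ioi i, lennardJones (dist (y i) (y j))) + ∑ i, ∑' q' : ↥X, lennardJones (dist (y i) (q' : E3)) := rfl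
  rw [hEz, hEy]
  simp only [Finset.sum_sub_distrib] at hint_sum hext_tot hlin ⊢
  linarith [hint_sum, hext_tot, hlin, hQ]

/-- sanity: the g95 glue is the instance `pl = pairLedgerLower` of the generic one. [formal bookkeeping] -/
example (hQL : SoftLedgerFloorP ϑc ϑ ϑp r rΘ q rsh ρ rm σ ϑr Rs ε rI ℓ Rg sb₁ dI₁ dB₁ sbp dIp dBp Rd τ c aHi Λ θ s) :
    SoftBregmanCoerciveP ϑc ϑ ϑp r rΘ q rsh ρ rm σ ϑr Rs ε rI ℓ Rg sb₁ dI₁ dB₁ sbp dIp dBp Rd τ c aHi Λ θ s :=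
  softBregmanCoerciveP_of_dominatedLedger (fun _ _ hx v => pairLedgerLower_le_pairTerm hx v) firstVariationP_holds (softLedgerFloorP_iff.1 hQL)

/-- ★★★ **(QL♯ᴸ) «SoftLedgerSharpP … Rg sb₁ dI₁ dB₁ sb⁺ dI⁺ dB⁺ Rd τ c …» — THE SHARP BONDWISE LEDGER FLOOR ON THE SOFT CONE, modulus `c`.**  The schema
`SoftLedgerFloorWithP` at `pl = pairLedgerSharp`: binders of (BCᴸ) verbatim; conclusion `c · pairDevSq ≤ Σ_bonds pairLedgerSharp` (compression charge +
exact stretch Bregman + TENSION CREDIT `max V' 0 · perpSq/(2‖b‖ + 2‖v‖)`), exterior families summable.  ENERGETIC-ALGEBRAIC (explicit in `‖b‖`, `‖b + v‖`,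
`‖v‖`, `⟪b, v⟫`; interval-arithmetic friendly) · LOCAL · NEW · THE CONTENT of the sharp-ledger branch · WEAKER than (QLᴸ) bond by bond
(`pairLedgerLower ≤ pairLedgerSharp`) · antitone in `c`.  TRUE-type EVIDENCE (desk «TENSION-CREDIT-95», long-wave = bulk infimum, whole conformal-admissible
family `IsConfChart s = 1/50` × iso scale `[0.9, 1]`): second-order sharp ledger = 89–100 % of the exact clamped floor (exact floor `μ₀ ∈ [2.5, 11]·10⁻⁴`
everywhere positive); `v`-independent windowed certificate (Jensen-point modulus with excursion `min(τ⋆, sb₁ + sb⁺)`, absorbed geometric cubic, tilt split) at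
the REGISTERED `(τ⋆, sb⁺) = (249/10000, 1/50)`: margins ≥ +41 % of `μ₀` at `sb₁ = 0`, ≥ +18 % at `1/400`, ≥ +10 % at `1/300`, one case −5 % at `1/200`.
Why it might fail: the inner-tube radius `sb₁` must come out `≤ 1/300` from (X2ᴸ′) (registered ceiling `249/20000` is 4× too fat: tilt and window
charges scale with `sb₁`), and a finite clamped patch must not undercut the bulk long-wave floor (Dirichlet data only raise it — to be confirmed by the
finite-patch instrument); fcc stackings only were scanned (hcp/twins pending).  Sources: arXiv:1202.3858 §5.2 (lattice stability by Bloch waves),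
doi:10.1051/m2an/2011014, doi:10.1007/s00205-015-0862-1, memo NODE-g95.md §1. [this file, g95] -/
def SoftLedgerSharpP (ϑc ϑ ϑp r rΘ q rsh ρ rm σ ϑr Rs ε rI ℓ Rg sb₁ dI₁ dB₁ sbp dIp dBp Rd τ c aHi Λ θ s : ℝ) : Prop :=
  SoftLedgerFloorWithP pairLedgerSharp ϑc ϑ ϑp r rΘ q rsh ρ rm σ ϑr Rs ε rI ℓ Rg sb₁ dI₁ dB₁ sbp dIp dBp Rd τ c aHi Λ θ s

/-- (QL♯ᴸ) is antitone in the modulus `c`. [formal bookkeeping] -/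
theorem SoftLedgerSharpP.of_le (hc : c' ≤ c)
    (h : SoftLedgerSharpP ϑc ϑ ϑp r rΘ q rsh ρ rm σ ϑr Rs ε rI ℓ Rg sb₁ dI₁ dB₁ sbp dIp dBp Rd τ c aHi Λ θ s) :
    SoftLedgerSharpP ϑc ϑ ϑp r rΘ q rsh ρ rm σ ϑr Rs ε rI ℓ Rg sb₁ dI₁ dB₁ sbp dIp dBp Rd τ c' aHi Λ θ s :=
  SoftLedgerFloorWithP.of_le hc h

/-- ★★★ **THE ONE-PIECE GLUE OF THE SHARP BRANCH (PROVED, all dials): (QL♯ᴸ)(c) ⟹ (BCᴸ)(c)** — generic glue at `pl = pairLedgerSharp` with the first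
variation discharged by ZZZYL's `firstVariationP_holds`. [this file, g95] -/
theorem softBregmanCoerciveP_of_sharpLedger
    (hQS : SoftLedgerSharpP ϑc ϑ ϑp r rΘ q rsh ρ rm σ ϑr Rs ε rI ℓ Rg sb₁ dI₁ dB₁ sbp dIp dBp Rd τ c aHi Λ θ s) :
    SoftBregmanCoerciveP ϑc ϑ ϑp r rΘ q rsh ρ rm σ ϑr Rs ε rI ℓ Rg sb₁ dI₁ dB₁ sbp dIp dBp Rd τ c aHi Λ θ s :=
  softBregmanCoerciveP_of_dominatedLedger (fun _ _ hx v => pairLedgerSharp_le_pairTerm hx v) firstVariationP_holds hQS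

/-- ★★★ **THE DOOR W2m (PROVED): `ϑc ≤ 5·10⁻¹²`, (X1ᴸ′)(lam > 0), (X2ᴸ′), (KAᴸ′), (QL♯ᴸ′)(c > 0) and (OGʰ′⋆)(g₀ > 0) ⟹ `[MCMC♮](ϑc)`** — tree W2h with its
Bregman leaf (BCᴸ′) carried by the SINGLE typed piece (QL♯ᴸ′) of the sharp-ledger branch (`sb₁, dI₁, dB₁, sb⁺, dI⁺, dB⁺` free; the desk certificate asks
for `sb₁ ≤ 1/300`). [this file, g95] -/
theorem mildCoherentMoatCorePG_W2m {ϑc sb₁ dI₁ dB₁ sbp dIp dBp lam c g₀ : ℝ} (hϑc : ϑc ≤ 1 / 200000000000) (hlam : 0 < lam) (hc : 0 < c) (hg₀ : 0 < g₀)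
    (hsb : 4 * sb₁ ≤ 249 / 5000) (hdI : 4 * dI₁ ≤ 249 / 5000) (hdB : dB₁ ≤ 2 / 5) (hsb₀ : 0 ≤ sb₁) (hdI₀ : 0 ≤ dI₁) (hdB₀ : 0 ≤ dB₁)
    (hX1 : LabelTubeConvexityP ϑc tameRadius (1 / 10) 8 (145 / 16) 4 12 16 16 (27 / 32) (1 / 10000) 5 (1 / 10000) 10 (43 / 2) (1 / 5000) (121 / 25)
      (249 / 5000) (249 / 5000) (21 / 50) lam 1 2 (1 / 16) (1 / 50))
    (hX2 : LabelLoadedTubeAprioriP ϑc tameRadius (1 / 10) 8 (145 / 16) 4 12 16 16 (27 / 32) (1 / 10000) 5 (1 / 10000) 10 (43 / 2) (1 / 5000)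
      (121 / 25) (249 / 5000) (249 / 5000) (21 / 50) sb₁ dI₁ dB₁ 1 2 (1 / 16) (1 / 50))
    (hKA : SoftCaptureP ϑc (1 / 10) 8 (145 / 16) 4 12 16 16 (27 / 32) (1 / 10000) 5 (1 / 10000) 10 (43 / 2) (121 / 25) sb₁ dI₁ dB₁ sbp dIp dBp
      (121 / 25) (249 / 10000) 1 2 (1 / 16) (1 / 50))
    (hQS : SoftLedgerSharpP ϑc tameRadius (1 / 10) 8 (145 / 16) 4 12 16 16 (27 / 32) (1 / 10000) 5 (1 / 10000) 10 (43 / 2) (121 / 25) sb₁ dI₁ dB₁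
      sbp dIp dBp (121 / 25) (249 / 10000) c 1 2 (1 / 16) (1 / 50))
    (hH : OffTubeHardGapMinP ϑc tameRadius (1 / 10) 8 (145 / 16) 4 12 16 16 (27 / 32) (1 / 10000) 5 (1 / 10000) 10 (43 / 2) (121 / 25) (249 / 5000)
      (249 / 5000) (21 / 50) sb₁ dI₁ dB₁ (121 / 25) (249 / 10000) g₀ 1 2 (1 / 16) (1 / 50)) :
    MildCoherentMoatCorePG ϑc tameRadius (1 / 10) 8 4 12 16 1 2 (1 / 16) (1 / 50) :=
  mildCoherentMoatCorePG_W2h hϑc hlam hc hg₀ hsb hdI hdB hsb₀ hdI₀ hdB₀ hX1 hX2 hKA (softBregmanCoerciveP_of_sharpLedger hQS) hH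

end SharpPiece

end Summit.AtomisticToContinuum.Crystallization.Theorems.ChartedZeroExcessLayeredLatticeLiouville
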